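import Summits.BirchSwinnertonDyer.BirchSwinnertonDyer.Theorems.GoldfeldAllTwistsTwoConverseTwinGenusDescentIndex
import HarnessLib

set_option linter.dupNamespace false -- `…BirchSwinnertonDyer.BirchSwinnertonDyer…` is the cell's namespace (D-0017)
set_option autoImplicit false

/-!
# LINE B49 — the FIXED partner curves, VII: the Tamagawa leaf of `W₇₈₄` and «BSD₂(784) exact» BY NAME

Cell `bsd-goldfeld`, seat `bsd-goldfeld-s1p-c301` (prover, gen 6); TARGET v5.5 §2 c301 (g), planner g16
ruling (xxxvii) FALLBACK («if Tate-at-2 for `I₄*` is out of reach this gen: ONE `@[conjecture]` leaf»);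
support for item `stmt-BirchSwinnertonDyer-19140` (twin″; joint with 20044). HONEST FRAMING: the named
input below is NOT open mathematics — it is the printed table value `∏ c_p = c₂·c₇ = 4·2 = 8` of the
conductor-`784` curve `[0, −21, 0, 112, 0] ≅ [0, 0, 0, −35, 98] = 49a1^{(−1)}` (Kodaira `I₄*` at `2`,
`III` at `7`; Cremona's Table 1), whose KERNEL evaluation is pending: the tree proves `c = 2` for type
`III` (`localTamagawaNumber_eq_two_of_kodairaSymbolAt_eq_III_holds`) but for `Iₙ*`, `n ≥ 1`, only
`c ∈ {2, 4}` (`localTamagawaNumber_of_kodairaSymbolAt_eq_Istar_succ_holds`); the exact `c₂ = 4` needs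
either the last rounds of Tate's Step 7 or the observation that the rational points `T = (0,0)`,
`g₇₈₄ = (8,8)`, `g₇₈₄ + T = (14, −14)` all reduce to the node of `y² = x³ + x²` over `𝔽₂`, giving
three non-zero classes in `E(ℚ₂)/E₀(ℚ₂)` (recorded for the successor). It is tagged like the line's
other named inputs so that seat c3's Theorem A (W-A5 of `GENUS-THEOREM-A.md`) can consume
«BSD₂(784) exact» BY NAME today: `leadingLCoeff_W784_of_tamagawaLeaf`. Nothing else is asserted; BSD is
not proved by any of this. Not in the Theses cone.
References: [CremonaAlgorithms1997] Table 1 (N = 784); [SilvermanATAEC1994] IV.9.4 Steps 4 and 7,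
Table 4.1; [CreutzMiller2012] Thm 1.1.
-/

noncomputable section

open scoped Classical

open WeierstrassCurve Literature.NumberTheory.EllipticCurves Literature.NumberTheory.EllipticCurves.ModularForms

namespace Summit.BirchSwinnertonDyer.BirchSwinnertonDyer.Theorems.GoldfeldGoodTwists

/-- **`X049Partner784TamagawaEight` — the Tamagawa leaf of LINE B49's fixed partner `W₇₈₄`** (a NAMED
INPUT; a printed, finitely checkable value whose kernel evaluation is pending — see the module
docstring; nothing is asserted): the product of the local Tamagawa numbers of the global minimal model
`W₇₈₄ = [0, −21, 0, 112, 0]` of `49a1^{(−1)}` (conductor `784 = 2⁴·7²`) is `c₂ · c₇ = 4 · 2 = 8`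
(Kodaira types `I₄*` at `2` and `III` at `7`). [cite: CremonaAlgorithms1997, Table 1 (N = 784)]
[cite: SilvermanATAEC1994, IV.9.4 Steps 4 and 7 and Table 4.1] -/
@[conjecture] def X049Partner784TamagawaEight : Prop :=
  (⟨0, -21, 0, 112, 0⟩ : WeierstrassCurve ℚ).tamagawaProduct = 8

/-- **«BSD₂(784) EXACT» BY NAME** (W-A5 of the genus Theorem A plan): granted bsd.S31
(`bsdTriple_of_rank_le_one_of_conductor_lt`), Modularity (`exists_isNewformOf`) and the Tamagawa leaf
`X049Partner784TamagawaEight`, the leading Taylor coefficient of `L(W₇₈₄, s)` at `s = 1` is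
`r · Ω(W₇₈₄) · ĥ(g₇₈₄)` with `r ∈ ℚ`, `v₂(r) = 1` (`r = 2·#Ш/k²`; everything else — rank `1`, `Ш[2] = 0`,
`#Ш` odd, `#E(ℚ)_tors = 2`, `ĥ(g₇₈₄) = k²·Reg` with `k` odd, the global minimal model and `N = 784` — is
a kernel theorem of files I–VI). [cite: CreutzMiller2012, Thm 1.1 and the remark following it]
[cite: CremonaAlgorithms1997, Table 1 (N = 784)] -/
theorem leadingLCoeff_W784_of_tamagawaLeaf (hS31 : bsdTriple_of_rank_le_one_of_conductor_lt)
    (hmod : exists_isNewformOf) (h8 : X049Partner784TamagawaEight) :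
    ∃ r : ℚ, padicValRat 2 r = 1 ∧
      (⟨0, -21, 0, 112, 0⟩ : WeierstrassCurve ℚ).leadingLCoeff =
        ((r : ℝ) * (⟨0, -21, 0, 112, 0⟩ : WeierstrassCurve ℚ).realPeriodRat *
          (Affine.Point.some 8 8 nonsingular_W784_eight_eight :
            (⟨0, -21, 0, 112, 0⟩ : WeierstrassCurve ℚ).toAffine.Point).canonicalHeight : ℝ) :=
  leadingLCoeff_W784_of_tamagawaProduct hS31 hmod h8

end Summit.BirchSwinnertonDyer.BirchSwinnertonDyer.Theorems.GoldfeldGoodTwists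

end
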